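/-
Copyright (c) 2026. All rights reserved.
Released under Apache 2.0 license as described in the file LICENSE.
-/
import Literature.Probability.FitznerVanDerHofstad2017.NobleBoundsNFirstSOpen
import Literature.Probability.FitznerVanDerHofstad2017.NobleBoundsNMidECut
import HarnessLib

/-!
# Fitzner–van der Hofstad (2017), §6.1 (6.4) / (5.4): the FIRST junction, variant `F″` cut through the apex (`z_0 = t_0 ≠ u_1`), off the corner `w_1 ~ t_0` — the start letter times term 2 at `u = t_0`

[FvdH17] = R. Fitzner, R. van der Hofstad, *Mean-field behavior for nearest-neighbor percolation in `d > 10`*,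
arXiv:1506.07977v2 (EJP 22 (2017), paper 43).  Page numbers refer to the arXiv version.

The first-junction copy of `NobleBoundsNMidECut`: junction `k = 0`, lower level = the start level ((4.57), p. 41),
upper level `1` of kind `midE` with `t_0 ≠ u_1` (`F″`, (4.58)) in the sub-regime `z_0 = t_0`, off the corner
`w_1 ~ t_0` (DIVERGENCE D77-R of the b2b-lace packet is NOT touched).  Exit class above is `a_1 = 2` by clause (8)
of `NobleJointNLevel.Conds` (`a_1 ≤ 1`: empty piece, `NobleBoundsNJointKit.nonempty_jPkg_of_sharp`).  Target
(LEMMAS ADDENDUM 16 §16.2, first-junction copy of row "(true,0) | 2 | t ≠ u′, ¬Adj"):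
`P^{S,a_0}(u_0,w_0) · (A^{κ,a_0,2}(u_0,w_0,w_1,t_0) · P^{S,0}(u_1 − t_0, u_1 − t_0))`
((5.1)–(5.4), pp. 46–48; App. B Tables "P^b" p. 73, "A^{ι,a,b}" rows `(a,≥2)` p. 75): the start letter is
`NobleBoundsNFirstSOpen.first_startLetter_gl` under the grouping `glFirstS3`; the `A`-letter reads the bond
`b_0`, `b̄_0 → w_1`, `w_1 ←≥2→ t_0` (`w_1 ≠ t_0` by the `midE` canon, not neighbours by hypothesis) and the exit
line `w_0 → z_0 = t_0` of the start level (slot `3`) — rows `piPerc_midF1_{zero,one,two}_two_le_blockAiota`; the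
letter `P^{S,0}(u_1 − t_0, u_1 − t_0) = ℙ(t_0 ⇔ u_1)` reads the two routes of the last sausage (slots `3, 4` of
level `1`) in one letter (`piPerc_end_zero_le_blockPE`, `P^{E,0} = P^{S,0}`).

§A the (4.65) rule for `glFirstS3` over a `midE` level and the readings; §B the parameter facts; §C the core,
the cell `nonempty_jPkg_firstE_cut` and the literal term-2 shapes `…_term₂` / `…_term₂'`.

Conventions: `d`-generic; nothing is cited as a fact; additive (no existing declaration is changed).  The
junction is written `(0 : Fin (M+1)).castSucc`, level `1` as `(0 : Fin (M+1)).succ`.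
-/

noncomputable section

namespace Literature.Probability.FitznerVanDerHofstad2017

open Literature.Barriers.CriticalPhenomena Literature.Probability.Percolation
open Literature.Probability.LatticeModels Literature.Combinatorics.SimpleGraph _root_.SimpleGraph
open _root_.MeasureTheory
open Literature.Probability.FitznerVanDerHofstad2017.NobleBlocks
open Literature.Probability.FitznerVanDerHofstad2017.NobleBlocks.LenIdx
open scoped ENNReal

variable {d : ℕ}

/-! ### A. The grouping over a `midE` level and the readings -/

section Grouping

variable (M : ℕ) (x : Site d) (b : Fin (M + 2) → Site d × Site d) (w t z : Fin (M + 2) → Site d)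
  (a : Fin (M + 2) → Fin 3 ⊕ Unit) (τ : Fin (M + 1) → Bool × Fin 3)

/-- **The grouping `glFirstS3` obeys the (4.65) rule over a `midE` level `1` too**: its only cross-level letter
joins start lines with the ENTRY slots `0, 1` of level `1` (a `midE` level has the entry slots `0, 1, 2`).
[cite: FitznerVanDerHofstad2017, §4.4 (4.65) and the sentence after it (arXiv:1506.07977v2 p. 43)] -/
theorem glFirstS3_entry_midE (hσ : (τ 0).1 = true) {a' : Fin 3} (ha' : a (0 : Fin (M + 1)).succ = Sum.inl a')
    (j j' : Fin 6) (hg : glFirstS3 (.lo j) = glFirstS3 (.up j')) :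
    IsEntry (pieceViews M x b w t z a τ (0 : Fin (M + 1)).castSucc.succ).kd j' := by
  rw [pieceViews_mid_kd, ha', hσ]
  show (j' : ℕ) < 3
  fin_cases j' <;> fin_cases j <;> simp [glFirstS3] at hg ⊢

end Grouping

section Letter

variable (p : unitInterval) (M : ℕ) (x : Site d) (b : Fin (M + 2) → Site d × Site d) (w t z : Fin (M + 2) → Site d)
  (a : Fin (M + 2) → Fin 3 ⊕ Unit) (τ : Fin (M + 1) → Bool × Fin 3)

/-- **Four-line reading of the letter `xb`** under `glFirstS3` over a `midE` level `1`: bond (level `0`),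
`b̄_0 → w_1`, `w_1 → t_0` (level `1`), the exit line of the start level (slot `3`).
[cite: FitznerVanDerHofstad2017, §4.2 (4.18) (arXiv:1506.07977v2 p. 35); §6.1 (6.4) (p. 58)] -/
theorem junF_firstECut_xb_le₄ (hσ : (τ 0).1 = true) {a' : Fin 3} (ha' : a (0 : Fin (M + 1)).succ = Sum.inl a')
    (EB X0 X1 X2 X3 E0 E1 E2 E3 E4 : Set (BondConfig (Site d))) :
    junF p M x b w t z a τ (0 : Fin (M + 1)).castSucc glFirstS3 true false (firstEvS EB X0 X1 X2 X3 E0 E1 E2 E3 E4)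
        .xb ≤
      piPerc d p 2 (genDisjOcc ![EB, E0, E1, X3] ![0, 1, 1, 0]) := by
  refine junF_le_of_lines p M x b w t z a τ (0 : Fin (M + 1)).castSucc glFirstS3 true false _ JIdx.xb
    ![JIdx.xb, .up 0, .up 1, .lo 3] (by decide) (fun m => ?_) ![0, 1, 1, 0] (fun m => by fin_cases m <;> rfl)
    ![EB, E0, E1, X3] (by funext m; fin_cases m <;> rfl)
  fin_cases m
  · exact ⟨rfl, rfl⟩
  · exact ⟨(jMidE_act_up_iff M x b w t z a τ 0 hσ ha' true false 0).2 (by decide), rfl⟩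
  · exact ⟨(jMidE_act_up_iff M x b w t z a τ 0 hσ ha' true false 1).2 (by decide), rfl⟩
  · exact ⟨(jFirst_act_lo_iff M x b w t z a τ true false 3).2 (by decide), rfl⟩

/-- **Two-line reading of the letter `up 2`** under `glFirstS3` over a `midE` level `1`: the two routes
`t_0 → u_1` (slot `3`) and `z_0 → u_1` (slot `4`) of the last sausage in ONE letter.
[cite: FitznerVanDerHofstad2017, §4.2 (4.16) (arXiv:1506.07977v2 p. 36); (4.58) (p. 41)] -/
theorem junF_firstECut_up_le₂ (hσ : (τ 0).1 = true) {a' : Fin 3} (ha' : a (0 : Fin (M + 1)).succ = Sum.inl a')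
    (EB X0 X1 X2 X3 E0 E1 E2 E3 E4 : Set (BondConfig (Site d))) :
    junF p M x b w t z a τ (0 : Fin (M + 1)).castSucc glFirstS3 true false (firstEvS EB X0 X1 X2 X3 E0 E1 E2 E3 E4)
        (.up 2) ≤
      piPerc d p 2 (genDisjOcc ![E3, E4] ![1, 1]) := by
  refine junF_le_of_lines p M x b w t z a τ (0 : Fin (M + 1)).castSucc glFirstS3 true false _ (JIdx.up 2)
    ![JIdx.up 3, .up 4] (by decide) (fun m => ?_) ![1, 1] (fun m => by fin_cases m <;> rfl)
    ![E3, E4] (by funext m; fin_cases m <;> rfl)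
  fin_cases m
  · exact ⟨(jMidE_act_up_iff M x b w t z a τ 0 hσ ha' true false 3).2 (by decide), rfl⟩
  · exact ⟨(jMidE_act_up_iff M x b w t z a τ 0 hσ ha' true false 4).2 (by decide), rfl⟩

end Letter

/-! ### B. The parameter facts -/

section CutFacts

variable {M : ℕ} {x : Site d} {b : Fin (M + 2) → Site d × Site d} {w t z : Fin (M + 2) → Site d}
  {a : Fin (M + 2) → Fin 3 ⊕ Unit} {c : Fin 3 ⊕ Unit} {τ : Fin (M + 1) → Bool × Fin 3}
  {ω : Fin (M + 3) → BondConfig (Site d)} {K₀ : Fin (M + 3) → Fin 6 → Set (Sym2 (Site d))}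

variable (M x b w t z a c τ) in
/-- The PARAMETER FACTS of a non-empty first-junction `F″` piece, read off `JFacts`: exit class `2` above (clause
(8)), `z_0 ≠ u_1`, `w_1 ≠ t_0`, `u_0 ∉ {t_0, w_1, z_0}`, `b̄_0 ≠ z_0`, `u_0 = 0 → w_0 = 0`, and the start class versus
the parameters. [cite: FitznerVanDerHofstad2017, (4.57)–(4.60), (4.64) and §6.1 "Case a" (arXiv:1506.07977v2 pp. 41–42, 58–59)] -/
theorem firstECut_facts (hF : JFacts M x b w t z a c τ ω K₀) (hσ : (τ 0).1 = true) {a₀ a' : Fin 3}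
    (ha : a (0 : Fin (M + 1)).castSucc = Sum.inl a₀) (ha' : a (0 : Fin (M + 1)).succ = Sum.inl a')
    (hty : t (0 : Fin (M + 1)).castSucc ≠ (b (0 : Fin (M + 1)).succ).1) :
    a' = 2 ∧ z (0 : Fin (M + 1)).castSucc ≠ (b (0 : Fin (M + 1)).succ).1 ∧
      w (0 : Fin (M + 1)).succ ≠ t (0 : Fin (M + 1)).castSucc ∧
      (b (0 : Fin (M + 1)).castSucc).1 ≠ t (0 : Fin (M + 1)).castSucc ∧
      (b (0 : Fin (M + 1)).castSucc).1 ≠ w (0 : Fin (M + 1)).succ ∧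
      (b (0 : Fin (M + 1)).castSucc).1 ≠ z (0 : Fin (M + 1)).castSucc ∧
      (b (0 : Fin (M + 1)).castSucc).2 ≠ z (0 : Fin (M + 1)).castSucc ∧
      ((b (0 : Fin (M + 1)).castSucc).1 = 0 → w (0 : Fin (M + 1)).castSucc = 0) ∧
      (a₀ = 0 → w (0 : Fin (M + 1)).castSucc = (b (0 : Fin (M + 1)).castSucc).1) ∧
      (a₀ = 1 → (zdGraph d).Adj (b (0 : Fin (M + 1)).castSucc).1 (w (0 : Fin (M + 1)).castSucc)) ∧
      (a₀ = 2 → (b (0 : Fin (M + 1)).castSucc).1 ≠ w (0 : Fin (M + 1)).castSucc) := by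
  have hv := hF.vac_midE 0 hσ ha'
  have hc := hF.canon_midE 0 hσ ha'
  have hcan : (b (0 : Fin (M + 1)).castSucc).1 = 0 → w (0 : Fin (M + 1)).castSucc = 0 := (hF.level 0).1
  refine ⟨hF.exitClass_succ_eq_two_of_sharp 0 hσ ha' hty, fun h => hty (hc.1.1 h), hc.2.resolve_right hty,
    fun h => hv (Or.inl h), fun h => hv (Or.inr (Or.inl h)), fun h => hv (Or.inr (Or.inr (Or.inl h))),
    hF.v_first_ne_z, hcan, ?_, ?_, ?_⟩
  · intro h0; exact hF.w_eq_of_exitClass_zero _ (ha.trans (by rw [h0]))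
  · intro h1; exact (hF.exitClass_one _ (ha.trans (by rw [h1]))).2.2
  · intro h2; exact hF.u_ne_w_of_exitClass_ne_zero _ ha (by rw [h2]; decide)

end CutFacts

/-! ### C. The core and the cells -/

section Packages

variable (p : unitInterval) (M : ℕ) (x : Site d) (b : Fin (M + 2) → Site d × Site d) (w t z : Fin (M + 2) → Site d)
  (a : Fin (M + 2) → Fin 3 ⊕ Unit) (c : Fin 3 ⊕ Unit) (τ : Fin (M + 1) → Bool × Fin 3)

/-- **The core of the first-junction cut-through packages**: start-letter data (`X0, X1, X2`), finitary events
`X3 ⊇` the exit witness of the start level, `E0, E1 ⊇` the witnesses of `b̄_0 → w_1`, `w_1 → t_0`, `E3, E4 ⊇` those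
of the two routes of the last sausage (its loop, slot `2`, carries the sure event), and bounds of the three letters
`lo 0 ≤ T₀`, `xb ≤ T₁`, `up 2 ≤ T₂` give a package with target `T₀ * (T₁ * T₂)`.
[cite: FitznerVanDerHofstad2017, §6.1 (6.4) (arXiv:1506.07977v2 p. 58); §4.4 (4.57)–(4.60), (4.65) (pp. 41, 43)] -/
theorem nonempty_jPkg_firstECut_core (κ : Fin d × Bool)
    (hb : (b (0 : Fin (M + 1)).castSucc).2 = (b (0 : Fin (M + 1)).castSucc).1 + stepVec κ) (hσ : (τ 0).1 = true)
    {a' : Fin 3} (ha' : a (0 : Fin (M + 1)).succ = Sum.inl a') (X0 X1 X2 X3 E0 E1 E3 E4 : Set (BondConfig (Site d)))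
    (f0 : IsFinitary X0) (f1 : IsFinitary X1) (f2 : IsFinitary X2) (f3 : IsFinitary X3) (h0 : IsFinitary E0)
    (h1 : IsFinitary E1) (h3 : IsFinitary E3) (h4 : IsFinitary E4)
    (hmem : ∀ ω K₀, JFacts M x b w t z a c τ ω K₀ →
      K₀ (0 : Fin (M + 1)).castSucc.castSucc 0 ∈ X0 ∧ K₀ (0 : Fin (M + 1)).castSucc.castSucc 1 ∈ X1 ∧
        K₀ (0 : Fin (M + 1)).castSucc.castSucc 2 ∈ X2 ∧ K₀ (0 : Fin (M + 1)).castSucc.castSucc 3 ∈ X3 ∧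
        K₀ (0 : Fin (M + 1)).castSucc.succ 0 ∈ E0 ∧ K₀ (0 : Fin (M + 1)).castSucc.succ 1 ∈ E1 ∧
        K₀ (0 : Fin (M + 1)).castSucc.succ 3 ∈ E3 ∧ K₀ (0 : Fin (M + 1)).castSucc.succ 4 ∈ E4)
    {T₀ T₁ T₂ : ℝ≥0∞}
    (hrow₀ : junF p M x b w t z a τ (0 : Fin (M + 1)).castSucc glFirstS3 true false
      (firstEvS (event (eq 1) (b (0 : Fin (M + 1)).castSucc).1 (b (0 : Fin (M + 1)).castSucc).2)
        X0 X1 X2 X3 E0 E1 Set.univ E3 E4) (.lo 0) ≤ T₀)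
    (hrow₁ : junF p M x b w t z a τ (0 : Fin (M + 1)).castSucc glFirstS3 true false
      (firstEvS (event (eq 1) (b (0 : Fin (M + 1)).castSucc).1 (b (0 : Fin (M + 1)).castSucc).2)
        X0 X1 X2 X3 E0 E1 Set.univ E3 E4) .xb ≤ T₁)
    (hrow₂ : junF p M x b w t z a τ (0 : Fin (M + 1)).castSucc glFirstS3 true false
      (firstEvS (event (eq 1) (b (0 : Fin (M + 1)).castSucc).1 (b (0 : Fin (M + 1)).castSucc).2)
        X0 X1 X2 X3 E0 E1 Set.univ E3 E4) (.up 2) ≤ T₂) :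
    Nonempty (JPkg p (jctx M x b w t z a τ (0 : Fin (M + 1)).castSucc) (JFacts M x b w t z a c τ)
      (T₀ * (T₁ * T₂))) := by
  have huv : (b (0 : Fin (M + 1)).castSucc).1 ≠ (b (0 : Fin (M + 1)).castSucc).2 := by
    rw [hb]; exact (zdGraph_adj_iff_stepVec _ _ |>.2 ⟨κ, rfl⟩).ne
  rw [← mul_assoc]
  refine nonempty_jPkg_of_joint p (0 : Fin (M + 1)).castSucc glFirstS3 true
    (firstEvS (event (eq 1) (b (0 : Fin (M + 1)).castSucc).1 (b (0 : Fin (M + 1)).castSucc).2)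
      X0 X1 X2 X3 E0 E1 Set.univ E3 E4)
    (isFinitary_firstEvS _ _ _ _ _ _ _ _ _ _ (isFinitary_event _ _ _) f0 f1 f2 f3 h0 h1 isFinitary_univ h3 h4)
    (fun _ => by rw [firstEvS_xb]; exact singleton_mem_event_eq_one huv)
    (fun j j' _ _ hg => glFirstS3_entry_midE M x b w t z a τ hσ ha' j j' hg)
    (fun ω K₀ hF => ⟨fun j hj => ?_, fun j hj => ?_⟩) ?_
  · -- the witnesses of the start level
    have hj4 : (j : ℕ) < 4 := (jFirst_act_lo_iff M x b w t z a τ true false j).1 hj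
    obtain ⟨m0, m1, m2, m3, -⟩ := hmem ω K₀ hF
    exact mem_firstEvS_lo _ _ _ _ _ _ _ _ _ _ m0 m1 m2 m3 j hj4
  · -- the witnesses of level `1`
    have hj5 : j ≠ 5 := (jMidE_act_up_iff M x b w t z a τ 0 hσ ha' true false j).1 hj
    obtain ⟨-, -, -, -, m0, m1, m3, m4⟩ := hmem ω K₀ hF
    exact mem_firstEvS_up _ _ _ _ _ _ _ _ _ _ m0 m1 (Set.mem_univ _) m3 m4 j hj5
  · -- three genuine letters
    exact (prod_junF_le₃ p M x b w t z a τ (0 : Fin (M + 1)).castSucc glFirstS3 true false _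
      (show JIdx.lo 0 ≠ JIdx.xb by decide) (show JIdx.lo 0 ≠ JIdx.up 2 by decide)
      (show JIdx.xb ≠ JIdx.up 2 by decide)).trans (mul_le_mul' (mul_le_mul' hrow₀ hrow₁) hrow₂)

/-- **The cut-through cells `(a_0, ·, a_1)` of the FIRST junction, variant `F″` (`t_0 ≠ u_1`), regime `z_0 = t_0`, off
the corner `w_1 ~ t_0`**: a package with target
`P^{S,a_0}(u_0,w_0) · (A^{κ,a_0,2}(u_0,w_0,w_1,t_0) · P^{S,0}(u_1 − t_0, u_1 − t_0))`; for `a_1 ≤ 1` the piece is empty.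
[cite: FitznerVanDerHofstad2017, §5.1 (5.1)–(5.4) (arXiv:1506.07977v2 pp. 46–48); §6.1 (6.4), "Case a = 0 / 1 / ≥ 2", "Cases a ≥ 1 and b ≥ 1" (pp. 58–59); App. B (pp. 73, 75)] -/
theorem nonempty_jPkg_firstE_cut (κ : Fin d × Bool)
    (hb : (b (0 : Fin (M + 1)).castSucc).2 = (b (0 : Fin (M + 1)).castSucc).1 + stepVec κ) (hσ : (τ 0).1 = true)
    (a₀ : Fin 3) (ha : a (0 : Fin (M + 1)).castSucc = Sum.inl a₀) {a' : Fin 3}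
    (ha' : a (0 : Fin (M + 1)).succ = Sum.inl a') (hty : t (0 : Fin (M + 1)).castSucc ≠ (b (0 : Fin (M + 1)).succ).1)
    (hzt : z (0 : Fin (M + 1)).castSucc = t (0 : Fin (M + 1)).castSucc)
    (hna : ¬ (zdGraph d).Adj (w (0 : Fin (M + 1)).succ) (t (0 : Fin (M + 1)).castSucc)) :
    Nonempty (JPkg p (jctx M x b w t z a τ (0 : Fin (M + 1)).castSucc) (JFacts M x b w t z a c τ)
      (blockPS (Letters.perc d p) a₀ (b (0 : Fin (M + 1)).castSucc).1 (w (0 : Fin (M + 1)).castSucc) *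
        (blockAiota (Letters.perc d p) κ a₀ a' (b (0 : Fin (M + 1)).castSucc).1 (w (0 : Fin (M + 1)).castSucc)
            (w (0 : Fin (M + 1)).succ) (t (0 : Fin (M + 1)).castSucc) *
          blockPS (Letters.perc d p) 0 ((b (0 : Fin (M + 1)).succ).1 - t (0 : Fin (M + 1)).castSucc)
            ((b (0 : Fin (M + 1)).succ).1 - t (0 : Fin (M + 1)).castSucc)))) := by
  -- exit class `a′ ≤ 1` above: the piece is empty (clause (8))
  by_cases h2 : a' = 2
  swap
  · exact nonempty_jPkg_of_sharp p c _ 0 hσ ha' h2 hty _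
  subst h2
  -- degenerate parameters: the piece is empty
  by_cases hP : (b (0 : Fin (M + 1)).castSucc).1 ≠ t (0 : Fin (M + 1)).castSucc ∧
      (b (0 : Fin (M + 1)).castSucc).1 ≠ w (0 : Fin (M + 1)).succ ∧
      (b (0 : Fin (M + 1)).castSucc).1 ≠ z (0 : Fin (M + 1)).castSucc ∧
      (b (0 : Fin (M + 1)).castSucc).2 ≠ z (0 : Fin (M + 1)).castSucc ∧
      w (0 : Fin (M + 1)).succ ≠ t (0 : Fin (M + 1)).castSucc ∧
      ((b (0 : Fin (M + 1)).castSucc).1 = 0 → w (0 : Fin (M + 1)).castSucc = 0) ∧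
      (a₀ = 0 → w (0 : Fin (M + 1)).castSucc = (b (0 : Fin (M + 1)).castSucc).1) ∧
      (a₀ = 1 → (zdGraph d).Adj (b (0 : Fin (M + 1)).castSucc).1 (w (0 : Fin (M + 1)).castSucc)) ∧
      (a₀ = 2 → (b (0 : Fin (M + 1)).castSucc).1 ≠ w (0 : Fin (M + 1)).castSucc)
  swap
  · refine ⟨JPkg.vacuous p _ _ (fun ω K₀ hF => hP ?_) _⟩
    obtain ⟨-, -, hwt, hut, huw', huz, hvz, hcan, hw0, hw1, hw2⟩ := firstECut_facts M x b w t z a c τ hF hσ ha ha' hty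
    exact ⟨hut, huw', huz, hvz, hwt, hcan, hw0, hw1, hw2⟩
  obtain ⟨hut, huw', huz, hvz, hwt, hcan, hw0, hw1, hw2⟩ := hP
  obtain ⟨X0, X1, X2, f0, f1, f2, hmem₀, hrow₀⟩ :=
    first_startLetter_gl p M x b w t z a c τ glFirstS3 true false (.lo 0) rfl rfl rfl ha hcan hw0 hw1 hw2
  refine nonempty_jPkg_firstECut_core p M x b w t z a c τ κ hb hσ ha' X0 X1 X2
    (endX a₀ (b (0 : Fin (M + 1)).castSucc).1 (w (0 : Fin (M + 1)).castSucc) (z (0 : Fin (M + 1)).castSucc))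
    (event (ge 0) (b (0 : Fin (M + 1)).castSucc).2 (w (0 : Fin (M + 1)).succ))
    (event (ge 2) (w (0 : Fin (M + 1)).succ) (t (0 : Fin (M + 1)).castSucc))
    (event (ge 0) (t (0 : Fin (M + 1)).castSucc) (b (0 : Fin (M + 1)).succ).1)
    (event (ge 0) (t (0 : Fin (M + 1)).castSucc) (b (0 : Fin (M + 1)).succ).1) f0 f1 f2 (isFinitary_endX _ _ _ _)
    (isFinitary_event _ _ _) (isFinitary_event _ _ _) (isFinitary_event _ _ _) (isFinitary_event _ _ _)
    (fun ω K₀ hF => ?_) (hrow₀ _ rfl rfl rfl) ?_ ?_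
  · obtain ⟨h0, h1, -, h3, h4⟩ := hF.conn_midE 0 hσ ha'
    rw [hzt] at h4
    refine ⟨(hmem₀ ω K₀ hF).1, (hmem₀ ω K₀ hF).2.1, (hmem₀ ω K₀ hF).2.2,
      firstSOpen_exit_mem M x b w t z a c τ hF huz hw0, ?_, ?_, ?_, ?_⟩
    · rw [event_ge]; exact mem_openConnGe_zero_of_mem h0
    · rw [event_ge]
      refine mem_openConnGe_two_of_notMem h1 hwt fun hm => hna ?_
      exact (SimpleGraph.mem_edgeSet _).1 (hF.lattice _ (hF.witness_subset _ 1 hm))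
    · rw [event_ge]; exact mem_openConnGe_zero_of_mem h3
    · rw [event_ge]; exact mem_openConnGe_zero_of_mem h4
  · refine (junF_firstECut_xb_le₄ p M x b w t z a τ hσ ha' _ _ _ _ _ _ _ _ _ _).trans ?_
    rw [hzt]
    unfold endX
    split_ifs with h0
    · subst h0
      rw [hw0 rfl]
      exact piPerc_midF1_zero_two_le_blockAiota p hb (fun h => hut h.symm) (fun h => huw' h.symm) _
    · obtain h1 | h2 : a₀ = 1 ∨ a₀ = 2 := by
        fin_cases a₀
        · exact absurd rfl h0
        · exact Or.inl rfl
        · exact Or.inr rfl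
      · subst h1
        obtain ⟨κ', hκ'⟩ := (zdGraph_adj_iff_stepVec _ _).1 (hw1 rfl)
        exact piPerc_midF1_one_two_le_blockAiota p hb hκ' _
      · subst h2
        exact piPerc_midF1_two_two_le_blockAiota p hb _
  · refine (junF_firstECut_up_le₂ p M x b w t z a τ hσ ha' _ _ _ _ _ _ _ _ _ _).trans ?_
    rw [← blockPE_zero]
    exact piPerc_end_zero_le_blockPE p rfl _ rfl

/-- **The first-junction cut-through cells in the literal shape of TERM 2** of `NobleBlocksPointwise.blockBpt` behind
the start letter: `P^{S,a_0}(u_0,w_0) · (δ_{z_0,t_0} · (A^{κ,a_0,a_1}(u_0,w_0,w_1,t_0) · P^{S,0}(u_1 − t_0, u_1 − t_0)))`,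
landed `A^κ` family. [cite: FitznerVanDerHofstad2017, §5.1 (5.4) second term (arXiv:1506.07977v2 p. 48); §6.1 (6.4) (p. 58); App. B (pp. 73, 75)] -/
theorem nonempty_jPkg_firstE_cut_term₂ (κ : Fin d × Bool)
    (hb : (b (0 : Fin (M + 1)).castSucc).2 = (b (0 : Fin (M + 1)).castSucc).1 + stepVec κ) (hσ : (τ 0).1 = true)
    (a₀ : Fin 3) (ha : a (0 : Fin (M + 1)).castSucc = Sum.inl a₀) {a' : Fin 3}
    (ha' : a (0 : Fin (M + 1)).succ = Sum.inl a') (hty : t (0 : Fin (M + 1)).castSucc ≠ (b (0 : Fin (M + 1)).succ).1)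
    (hzt : z (0 : Fin (M + 1)).castSucc = t (0 : Fin (M + 1)).castSucc)
    (hna : ¬ (zdGraph d).Adj (w (0 : Fin (M + 1)).succ) (t (0 : Fin (M + 1)).castSucc)) :
    Nonempty (JPkg p (jctx M x b w t z a τ (0 : Fin (M + 1)).castSucc) (JFacts M x b w t z a c τ)
      (blockPS (Letters.perc d p) a₀ (b (0 : Fin (M + 1)).castSucc).1 (w (0 : Fin (M + 1)).castSucc) *
        (kd (z (0 : Fin (M + 1)).castSucc) (t (0 : Fin (M + 1)).castSucc) *
          (blockAiota (Letters.perc d p) κ a₀ a' (b (0 : Fin (M + 1)).castSucc).1 (w (0 : Fin (M + 1)).castSucc)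
              (w (0 : Fin (M + 1)).succ) (t (0 : Fin (M + 1)).castSucc) *
            blockPS (Letters.perc d p) 0 ((b (0 : Fin (M + 1)).succ).1 - t (0 : Fin (M + 1)).castSucc)
              ((b (0 : Fin (M + 1)).succ).1 - t (0 : Fin (M + 1)).castSucc))))) := by
  rw [hzt, kd_self, one_mul]
  exact nonempty_jPkg_firstE_cut p M x b w t z a c τ κ hb hσ a₀ ha ha' hty hzt hna

/-- The same against the PRIMED `A^κ` family (equal on the non-empty pieces: `a_1 = 2`).
[cite: FitznerVanDerHofstad2017, §5.1 (5.4) second term (arXiv:1506.07977v2 p. 48); §6.1 (6.4) (pp. 58–59); App. B (pp. 73, 75)] -/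
theorem nonempty_jPkg_firstE_cut_term₂' (κ : Fin d × Bool)
    (hb : (b (0 : Fin (M + 1)).castSucc).2 = (b (0 : Fin (M + 1)).castSucc).1 + stepVec κ) (hσ : (τ 0).1 = true)
    (a₀ : Fin 3) (ha : a (0 : Fin (M + 1)).castSucc = Sum.inl a₀) {a' : Fin 3}
    (ha' : a (0 : Fin (M + 1)).succ = Sum.inl a') (hty : t (0 : Fin (M + 1)).castSucc ≠ (b (0 : Fin (M + 1)).succ).1)
    (hzt : z (0 : Fin (M + 1)).castSucc = t (0 : Fin (M + 1)).castSucc)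
    (hna : ¬ (zdGraph d).Adj (w (0 : Fin (M + 1)).succ) (t (0 : Fin (M + 1)).castSucc)) :
    Nonempty (JPkg p (jctx M x b w t z a τ (0 : Fin (M + 1)).castSucc) (JFacts M x b w t z a c τ)
      (blockPS (Letters.perc d p) a₀ (b (0 : Fin (M + 1)).castSucc).1 (w (0 : Fin (M + 1)).castSucc) *
        (kd (z (0 : Fin (M + 1)).castSucc) (t (0 : Fin (M + 1)).castSucc) *
          (blockAiota' (Letters.perc d p) κ a₀ a' (b (0 : Fin (M + 1)).castSucc).1 (w (0 : Fin (M + 1)).castSucc)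
              (w (0 : Fin (M + 1)).succ) (t (0 : Fin (M + 1)).castSucc) *
            blockPS (Letters.perc d p) 0 ((b (0 : Fin (M + 1)).succ).1 - t (0 : Fin (M + 1)).castSucc)
              ((b (0 : Fin (M + 1)).succ).1 - t (0 : Fin (M + 1)).castSucc))))) := by
  by_cases h2 : a' = 2
  · subst h2
    rw [blockAiota'_of_ne _ _ (fun h => absurd h.2 (by decide))]
    exact nonempty_jPkg_firstE_cut_term₂ p M x b w t z a c τ κ hb hσ a₀ ha ha' hty hzt hna
  · exact nonempty_jPkg_of_sharp p c _ 0 hσ ha' h2 hty _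

end Packages

end Literature.Probability.FitznerVanDerHofstad2017

end
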